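import Summits.Ventures.QEC.CircuitDistance.PortWindow
import Summits.Ventures.QEC.CircuitDistance.SMSchedule
import Summits.Ventures.QEC.CircuitDistance.SchedCleanCycle
import HarnessLib

/-!
# One-cycle witnesses persist: `HasLogicalFaultOfWeightAtMostAtₛ σ S 1 w → ∀ Nc ≥ 1, HasLogicalFaultOfWeightAtMostAtₛ σ S Nc w`
# for EVERY CNOT order `σ` (venture QEC, experiment cell CDX, Q4 lane; generic in `σ` and `S`; nothing here asserts a value of `d_circ`)

Provenance: drafted by qec-cdx-idea-2 g2 (2026-08-29, director-qec R156 (4) «ₛ-mono»; v2 = dedup against the landed SchedCleanCycle),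
typed by qec-cdx-type-2, statement audit qec-cdx-crit-1. Imports `PortWindow` (retag bookkeeping of record) + `SMSchedule` + `SchedCleanCycle`.

WHY A SEPARATE ARGUMENT. The landed `hasAt_mono_cycles` (`PortNormalise.lean`) goes through NORMALISATION and the CLEAN-CYCLE lemma
`evolve_cycleEvents` (`PortCleanCycle.lean`), which is a structural computation of PRINT's cycle and does not transfer to another order
without re-proof. For the shape the Q4 claims need — a ONE-cycle witness holding at every `Nc ≥ 1` — no clean-cycle lemma is needed:
place the set in the LAST cycle. Causality does the rest:
* `run1_retag_last`: for a cycle-1 fault `f`, `Gen.run1 S (allEventsₛ σ Nc) (f.retag Nc)` is `Gen.run1 S (allEventsₛ σ 1) f` with the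
  outcome slots `1 ↔ Nc` swapped (the first `Nc−1` cycles are fault-free and fix the all-clear state: `simulate_of_not_mem`,
  `evolve_init`; the last cycle is cycle 1 retagged: `cycleEventsₛ_retag`, `simulate_retag_swap` of `PortCleanCycle.lean`, generic in
  the event list);
* `oneCycle_flips_eq_false` / `oneCycle_final_eq_false`: a set undetectable in the ONE-cycle circuit flips no outcome at all and leaves
  a residual with zero true syndrome (detector layer 1 = the flips of cycle 1, layer 2 = true syndrome ⊕ flips of cycle 1);
* hence the retagged set flips nothing, has the same residual data error (`dataX_retag_last`, `dataZ_retag_last`), is undetectable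
  in the `Nc`-cycle circuit (`undetectable_of_silent`), is logical iff the original is, and has no more faulty operations
  (`faultCount_image_retag_le`): **`hasAtₛ_of_one`**.
All lemmas used from the tree (`simulate_append`, `simulate_of_not_mem`, `evolve_init`, `simulate_slots_of_ne`, `simulate_retag_swap`,
`bsum_image_of_injOn`, `bsum_congr`, `bsum_false`, `Fault.ev_cyc/ev_retag/cyc_retag/retag_retag/retag_self/loc_retag`) are generic in
the event list; nothing order-specific enters.
-/

/- v2 (2026-08-29T00:46Z, crit-1 00:43:30Z dedup blocker): `Ev.cyc_retag`, `Ev.retag_retag`, `cyc_of_mem_cycleEventsₛ`,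
`cycleEventsₛ_retag`, `allEventsₛ_succ` are now IMPORTED from the landed `SchedCleanCycle` (p681173) instead of re-declared; call sites
use the tree binder order (`cyc_of_mem_cycleEventsₛ σ h`). No statement of this file's own theorems changed. -/

namespace Summit.Ventures.QEC.CircuitDistance

open Literature.InformationTheory.QuantumCodes

variable {ℓ m : ℕ}

/-! ## Event bookkeeping for schedules -/

/-- No cycles, no events. -/
theorem allEventsₛ_zero (σ : SMSchedule) : allEventsₛ σ 0 = [] := rfl

/-- The one-cycle circuit is cycle 1. -/
theorem allEventsₛ_one (σ : SMSchedule) : allEventsₛ σ 1 = cycleEventsₛ σ 1 := by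
  rw [allEventsₛ_succ, allEventsₛ_zero, List.nil_append]

/-- Events of the `Nc`-cycle circuit carry cycle tags in `1 … Nc` (cf. `mem_allEvents_iff`, one direction). -/
theorem cyc_of_mem_allEventsₛ (σ : SMSchedule) (Nc : ℕ) (e : Ev) (h : e ∈ allEventsₛ σ Nc) : 1 ≤ e.cyc ∧ e.cyc ≤ Nc := by
  unfold allEventsₛ at h
  rw [List.mem_flatMap] at h
  obtain ⟨c, hc, he⟩ := h
  rw [List.mem_range] at hc
  have := cyc_of_mem_cycleEventsₛ σ he
  omega

/-- Cycle `c ∈ {1,…,Nc}` is part of the `Nc`-cycle circuit. -/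
theorem mem_allEventsₛ_of_mem_cycleEventsₛ (σ : SMSchedule) {c Nc : ℕ} (h1 : 1 ≤ c) (h2 : c ≤ Nc) {e : Ev}
    (he : e ∈ cycleEventsₛ σ c) : e ∈ allEventsₛ σ Nc := by
  unfold allEventsₛ
  rw [List.mem_flatMap]
  refine ⟨c - 1, List.mem_range.2 (by omega), ?_⟩
  rwa [Nat.sub_add_cancel h1]

/-- A fault sitting on an event of the one-cycle circuit is a cycle-1 fault. -/
theorem cyc_eq_one_of_mem [NeZero ℓ] [NeZero m] (σ : SMSchedule) (f : Fault ℓ m) (h : f.ev ∈ allEventsₛ σ 1) : f.cyc = 1 := by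
  have := cyc_of_mem_allEventsₛ σ 1 f.ev h
  rw [Fault.ev_cyc] at this
  omega

section
variable [NeZero ℓ] [NeZero m]

/-! ## Last-cycle placement of a cycle-1 fault -/

omit [NeZero ℓ] [NeZero m] in
/-- The all-clear state has nothing to swap. -/
theorem State.init_swapSlots (a b : ℕ) : (State.init : State ℓ m).swapSlots a b = State.init := rfl

omit [NeZero ℓ] [NeZero m] in
/-- Swapping outcome slots keeps the frame. -/
theorem State.frame_swapSlots (st : State ℓ m) (a b : ℕ) : (st.swapSlots a b).frame = st.frame := rfl

omit [NeZero ℓ] [NeZero m] in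
/-- Swapped `X`-outcome slots. -/
theorem State.mX_swapSlots (st : State ℓ m) (a b t : ℕ) (i : BB.Mono ℓ m) :
    (st.swapSlots a b).mX t i = st.mX (Equiv.swap a b t) i := rfl

omit [NeZero ℓ] [NeZero m] in
/-- Swapped `Z`-outcome slots. -/
theorem State.mZ_swapSlots (st : State ℓ m) (a b t : ℕ) (j : BB.Mono ℓ m) :
    (st.swapSlots a b).mZ t j = st.mZ (Equiv.swap a b t) j := rfl

/-- **LAST-CYCLE PLACEMENT**: the run of a cycle-1 fault retagged to the last cycle `Nc` of the `Nc`-cycle circuit is the one-cycle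
run with outcome slots `1 ↔ Nc` swapped (same frame). -/
theorem run1_retag_last (σ : SMSchedule) (S : SMCode ℓ m) {Nc : ℕ} (hNc : 1 ≤ Nc) (f : Fault ℓ m) (hf : f.cyc = 1) :
    Gen.run1 S (allEventsₛ σ Nc) (f.retag Nc) = (Gen.run1 S (allEventsₛ σ 1) f).swapSlots 1 Nc := by
  obtain ⟨k, rfl⟩ : ∃ k, Nc = k + 1 := ⟨Nc - 1, by omega⟩
  unfold Gen.run1
  have hnot : (f.retag (k + 1)).ev ∉ allEventsₛ σ k := by
    intro hmem
    have h2 := (cyc_of_mem_allEventsₛ σ k _ hmem).2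
    rw [Fault.ev_cyc, Fault.cyc_retag] at h2
    omega
  rw [allEventsₛ_succ, simulate_append, simulate_of_not_mem S _ hnot, evolve_init, allEventsₛ_one,
    ← cycleEventsₛ_retag σ 1 (k + 1)]
  have h := simulate_retag_swap S f (k + 1) (cycleEventsₛ σ 1)
    (fun e he => by rw [cyc_of_mem_cycleEventsₛ σ he, hf]) State.init
  rw [hf, State.init_swapSlots] at h
  exact h

/-- In the one-cycle circuit a cycle-1 fault writes only outcome slot 1. -/
theorem run1_one_slots (σ : SMSchedule) (S : SMCode ℓ m) (f : Fault ℓ m) (hf : f.cyc = 1) {t : ℕ} (ht : t ≠ 1) :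
    (∀ i, (Gen.run1 S (allEventsₛ σ 1) f).mX t i = false) ∧ (∀ j, (Gen.run1 S (allEventsₛ σ 1) f).mZ t j = false) := by
  unfold Gen.run1
  rw [allEventsₛ_one]
  exact simulate_slots_of_ne S f 1 hf (cycleEventsₛ σ 1) (fun e he => cyc_of_mem_cycleEventsₛ σ he) State.init
    (fun _ _ => ⟨fun _ => rfl, fun _ => rfl⟩) t ht

/-! ## Set-level transfer -/

omit [NeZero ℓ] [NeZero m] in
/-- Retagging is injective on cycle-1 faults. -/
theorem retag_injOn_of_cyc (F : Finset (Fault ℓ m)) (hF : ∀ f ∈ F, f.cyc = 1) (Nc : ℕ) :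
    Set.InjOn (Fault.retag Nc) (F : Set (Fault ℓ m)) := by
  intro f hf g hg h
  have h1 : (f.retag Nc).retag 1 = (g.retag Nc).retag 1 := by rw [h]
  rw [Fault.retag_retag, Fault.retag_retag] at h1
  have ef := Fault.retag_self f
  have eg := Fault.retag_self g
  rw [hF f hf] at ef
  rw [hF g hg] at eg
  rw [ef, eg] at h1
  exact h1

/-- Outcome flips of the retagged set = outcome flips of the original with slots `1 ↔ Nc` swapped (`X`-checks). -/
theorem flipX_retag_last (σ : SMSchedule) (S : SMCode ℓ m) {Nc : ℕ} (hNc : 1 ≤ Nc) (F : Finset (Fault ℓ m))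
    (hF : ∀ f ∈ F, f.cyc = 1) (t : ℕ) (i : BB.Mono ℓ m) :
    Gen.flipX S (allEventsₛ σ Nc) (F.image (Fault.retag Nc)) t i = Gen.flipX S (allEventsₛ σ 1) F (Equiv.swap 1 Nc t) i := by
  unfold Gen.flipX
  rw [bsum_image_of_injOn (retag_injOn_of_cyc F hF Nc)]
  exact bsum_congr fun f hf => by
    simp only [Function.comp_apply]
    rw [run1_retag_last σ S hNc f (hF f hf), State.mX_swapSlots]

/-- (`Z`-checks). -/
theorem flipZ_retag_last (σ : SMSchedule) (S : SMCode ℓ m) {Nc : ℕ} (hNc : 1 ≤ Nc) (F : Finset (Fault ℓ m))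
    (hF : ∀ f ∈ F, f.cyc = 1) (t : ℕ) (j : BB.Mono ℓ m) :
    Gen.flipZ S (allEventsₛ σ Nc) (F.image (Fault.retag Nc)) t j = Gen.flipZ S (allEventsₛ σ 1) F (Equiv.swap 1 Nc t) j := by
  unfold Gen.flipZ
  rw [bsum_image_of_injOn (retag_injOn_of_cyc F hF Nc)]
  exact bsum_congr fun f hf => by
    simp only [Function.comp_apply]
    rw [run1_retag_last σ S hNc f (hF f hf), State.mZ_swapSlots]

/-- Frame-based parities are unchanged by last-cycle placement. -/
theorem bsum_frame_retag_last (σ : SMSchedule) (S : SMCode ℓ m) {Nc : ℕ} (hNc : 1 ≤ Nc) (F : Finset (Fault ℓ m))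
    (hF : ∀ f ∈ F, f.cyc = 1) (P : Frame ℓ m → Bool) :
    bsum (F.image (Fault.retag Nc)) (fun f => P (Gen.run1 S (allEventsₛ σ Nc) f).frame) =
      bsum F (fun f => P (Gen.run1 S (allEventsₛ σ 1) f).frame) := by
  rw [bsum_image_of_injOn (retag_injOn_of_cyc F hF Nc)]
  exact bsum_congr fun f hf => by
    simp only [Function.comp_apply]
    rw [run1_retag_last σ S hNc f (hF f hf), State.frame_swapSlots]

/-- The residual `X`-type data error is unchanged by last-cycle placement. -/
theorem dataX_retag_last (σ : SMSchedule) (S : SMCode ℓ m) {Nc : ℕ} (hNc : 1 ≤ Nc) (F : Finset (Fault ℓ m))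
    (hF : ∀ f ∈ F, f.cyc = 1) :
    Gen.dataX S (allEventsₛ σ Nc) (F.image (Fault.retag Nc)) = Gen.dataX S (allEventsₛ σ 1) F := by
  funext q
  show (if bsum (F.image (Fault.retag Nc))
      (fun f => (fun fr : Frame ℓ m => (fr (q.elim (fun i => (Reg.L, i)) fun i => (Reg.R, i))).1)
        (Gen.run1 S (allEventsₛ σ Nc) f).frame) then (1 : ZMod 2) else 0) = _
  rw [bsum_frame_retag_last σ S hNc F hF (fun fr : Frame ℓ m => (fr (q.elim (fun i => (Reg.L, i)) fun i => (Reg.R, i))).1)]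
  rfl

/-- The residual `Z`-type data error is unchanged by last-cycle placement. -/
theorem dataZ_retag_last (σ : SMSchedule) (S : SMCode ℓ m) {Nc : ℕ} (hNc : 1 ≤ Nc) (F : Finset (Fault ℓ m))
    (hF : ∀ f ∈ F, f.cyc = 1) :
    Gen.dataZ S (allEventsₛ σ Nc) (F.image (Fault.retag Nc)) = Gen.dataZ S (allEventsₛ σ 1) F := by
  funext q
  show (if bsum (F.image (Fault.retag Nc))
      (fun f => (fun fr : Frame ℓ m => (fr (q.elim (fun i => (Reg.L, i)) fun i => (Reg.R, i))).2)
        (Gen.run1 S (allEventsₛ σ Nc) f).frame) then (1 : ZMod 2) else 0) = _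
  rw [bsum_frame_retag_last σ S hNc F hF (fun fr : Frame ℓ m => (fr (q.elim (fun i => (Reg.L, i)) fun i => (Reg.R, i))).2)]
  rfl

/-! ## A one-cycle undetectable set is silent -/

/-- In the one-cycle circuit, an undetectable set of cycle-1 faults flips NO outcome (`X`-checks)… -/
theorem oneCycle_flipX_eq_false (σ : SMSchedule) (S : SMCode ℓ m) (F : Finset (Fault ℓ m))
    (hU : Gen.Undetectable S 1 (allEventsₛ σ 1) F) (t : ℕ) (i : BB.Mono ℓ m) : Gen.flipX S (allEventsₛ σ 1) F t i = false := by
  have hF : ∀ f ∈ F, f.cyc = 1 := fun f hf => cyc_eq_one_of_mem σ f (hU.1 f hf)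
  have hoff : ∀ t, t ≠ 1 → Gen.flipX S (allEventsₛ σ 1) F t i = false := fun t ht => by
    unfold Gen.flipX
    rw [bsum_congr (h := fun _ => false) (fun f hf => (run1_one_slots σ S f (hF f hf) ht).1 i)]
    exact bsum_false _
  by_cases ht : t = 1
  · subst ht
    have h1 := (hU.2 1 i).1
    unfold Gen.detX at h1
    rw [if_neg one_ne_zero, if_pos le_rfl, hoff 0 zero_ne_one] at h1
    simpa using h1
  · exact hoff t ht

/-- … (`Z`-checks) … -/
theorem oneCycle_flipZ_eq_false (σ : SMSchedule) (S : SMCode ℓ m) (F : Finset (Fault ℓ m))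
    (hU : Gen.Undetectable S 1 (allEventsₛ σ 1) F) (t : ℕ) (j : BB.Mono ℓ m) : Gen.flipZ S (allEventsₛ σ 1) F t j = false := by
  have hF : ∀ f ∈ F, f.cyc = 1 := fun f hf => cyc_eq_one_of_mem σ f (hU.1 f hf)
  have hoff : ∀ t, t ≠ 1 → Gen.flipZ S (allEventsₛ σ 1) F t j = false := fun t ht => by
    unfold Gen.flipZ
    rw [bsum_congr (h := fun _ => false) (fun f hf => (run1_one_slots σ S f (hF f hf) ht).2 j)]
    exact bsum_false _
  by_cases ht : t = 1
  · subst ht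
    have h1 := (hU.2 1 j).2
    unfold Gen.detZ at h1
    rw [if_neg one_ne_zero, if_pos le_rfl, hoff 0 zero_ne_one] at h1
    simpa using h1
  · exact hoff t ht

/-- … and leaves a residual with zero TRUE `X`-check syndrome … -/
theorem oneCycle_finalX_eq_false (σ : SMSchedule) (S : SMCode ℓ m) (F : Finset (Fault ℓ m))
    (hU : Gen.Undetectable S 1 (allEventsₛ σ 1) F) (i : BB.Mono ℓ m) :
    decide ((S.toCode.HX.mulVec (Gen.dataZ S (allEventsₛ σ 1) F)) i = 1) = false := by
  have h2 := (hU.2 2 i).1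
  unfold Gen.detX at h2
  rw [if_neg two_ne_zero, if_neg (by omega), if_pos rfl, oneCycle_flipX_eq_false σ S F hU 1 i] at h2
  simpa using h2

/-- … and zero TRUE `Z`-check syndrome. -/
theorem oneCycle_finalZ_eq_false (σ : SMSchedule) (S : SMCode ℓ m) (F : Finset (Fault ℓ m))
    (hU : Gen.Undetectable S 1 (allEventsₛ σ 1) F) (j : BB.Mono ℓ m) :
    decide ((S.toCode.HZ.mulVec (Gen.dataX S (allEventsₛ σ 1) F)) j = 1) = false := by
  have h2 := (hU.2 2 j).2
  unfold Gen.detZ at h2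
  rw [if_neg two_ne_zero, if_neg (by omega), if_pos rfl, oneCycle_flipZ_eq_false σ S F hU 1 j] at h2
  simpa using h2

/-- A SILENT set (on events of the circuit, no outcome flipped, zero true residual syndromes) is undetectable, any `Nc`, any `es`. -/
theorem Gen.undetectable_of_silent (S : SMCode ℓ m) (Nc : ℕ) (es : List Ev) (F : Finset (Fault ℓ m))
    (hmem : ∀ f ∈ F, f.ev ∈ es) (hX : ∀ t i, Gen.flipX S es F t i = false) (hZ : ∀ t j, Gen.flipZ S es F t j = false)
    (hfX : ∀ i, decide ((S.toCode.HX.mulVec (Gen.dataZ S es F)) i = 1) = false)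
    (hfZ : ∀ j, decide ((S.toCode.HZ.mulVec (Gen.dataX S es F)) j = 1) = false) : Gen.Undetectable S Nc es F := by
  refine ⟨hmem, fun t i => ⟨?_, ?_⟩⟩
  · unfold Gen.detX; rw [hX, hX, hX, hfX]; split_ifs <;> rfl
  · unfold Gen.detZ; rw [hZ, hZ, hZ, hfZ]; split_ifs <;> rfl

omit [NeZero ℓ] [NeZero m] in
/-- Retagging a set of faults to one cycle does not increase the number of faulty operations. -/
theorem faultCount_image_retag_le (F : Finset (Fault ℓ m)) (Nc : ℕ) :
    faultCount (F.image (Fault.retag Nc)) ≤ faultCount F := by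
  classical
  unfold faultCount
  rw [Finset.image_image]
  have : (Fault.loc ∘ Fault.retag Nc : Fault ℓ m → Loc ℓ m) = Loc.retag Nc ∘ Fault.loc := by
    funext f; exact Fault.loc_retag f Nc
  rw [this, ← Finset.image_image]
  exact Finset.card_image_le

/-- **ONE-CYCLE WITNESSES PERSIST** (any order `σ`, any circuit data `S`): an undetectable logical fault set of `≤ w` operations of the
ONE-cycle circuit yields one in the `Nc`-cycle circuit for every `Nc ≥ 1` (the same operations, performed in the last cycle). -/
theorem hasAtₛ_of_one (σ : SMSchedule) (S : SMCode ℓ m) (w : ℕ) (h : HasLogicalFaultOfWeightAtMostAtₛ σ S 1 w) :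
    ∀ Nc : ℕ, 1 ≤ Nc → HasLogicalFaultOfWeightAtMostAtₛ σ S Nc w := by
  intro Nc hNc
  obtain ⟨F, hU, hL, hw⟩ := h
  have hF : ∀ f ∈ F, f.cyc = 1 := fun f hf => cyc_eq_one_of_mem σ f (hU.1 f hf)
  refine ⟨F.image (Fault.retag Nc), ?_, ?_, (faultCount_image_retag_le F Nc).trans hw⟩
  · refine Gen.undetectable_of_silent S Nc _ _ ?_ ?_ ?_ ?_ ?_
    · intro f' hf'
      obtain ⟨f, hf, rfl⟩ := Finset.mem_image.1 hf'
      have hev : f.ev ∈ cycleEventsₛ σ 1 := by rw [← allEventsₛ_one]; exact hU.1 f hf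
      refine mem_allEventsₛ_of_mem_cycleEventsₛ σ hNc le_rfl ?_
      rw [Fault.ev_retag, ← cycleEventsₛ_retag σ 1 Nc]
      exact List.mem_map.2 ⟨f.ev, hev, rfl⟩
    · intro t i; rw [flipX_retag_last σ S hNc F hF]; exact oneCycle_flipX_eq_false σ S F hU _ i
    · intro t j; rw [flipZ_retag_last σ S hNc F hF]; exact oneCycle_flipZ_eq_false σ S F hU _ j
    · intro i; rw [dataZ_retag_last σ S hNc F hF]; exact oneCycle_finalX_eq_false σ S F hU i
    · intro j; rw [dataX_retag_last σ S hNc F hF]; exact oneCycle_finalZ_eq_false σ S F hU j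
  · unfold Gen.LogicalError at hL ⊢
    rwa [dataX_retag_last σ S hNc F hF, dataZ_retag_last σ S hNc F hF]

/-- The `∃ Nc` form from a one-cycle witness. -/
theorem hasₛ_of_one (σ : SMSchedule) (S : SMCode ℓ m) (w : ℕ) (h : HasLogicalFaultOfWeightAtMostAtₛ σ S 1 w) :
    HasLogicalFaultOfWeightAtMostₛ σ S w := ⟨1, h⟩

end

end Summit.Ventures.QEC.CircuitDistance
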